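import Summits.Ventures.PercRepro.MSTightTighteningSplit
import Summits.Ventures.PercRepro.MSTightConjTReductions

/-!
# The local dichotomy: Conjecture (T) on the open shape reduced to a statement about an
# excess-one subfamily of a tight family

Dossier proofs/MINE1-theoremS.md, Addendum 50 supplement 3. At a tightening direction `r` of an
excess-one family `F` in case (β) of the tightening split (`X ∩ Y = K \\ K`, `|K \\ K| = |K| + 1`,
`F₁ \\ K = K \\ K = K \\ F₀`), the partner family `K` is an excess-one subfamily of the tight trace
`P = proj r F`, the partnerless members `P₁ = F₁ ∖ F₀`, `P₀ = F₀ ∖ F₁` partition `P ∖ K`, and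
`P₁ \\ K ⊆ K \\ K`, `K \\ P₀ ⊆ K \\ K`. The CANDIDATE PROP `LocalDichotomy α` (never asserted)
says that these LOCAL data alone — no global count — force every member of `P₁` below a member of
`K` as soon as `|P₀|, |P₁| ≥ 2` (census: all 1,080 such colourings of all tight genuine twin-free
traces on a 5-element ground set, every value of `exc(F)` allowed; 96 hill-climbed colourings on 6
and 7 elements — in every one of them `exc(F) = 1`, both (DICH) clauses and (T) hold).
**Bridge** (`diffsY_subset_diffsX_of_localDichotomy`): `LocalDichotomy α` gives Conjecture (T)
at every genuine twin-free tightening direction in case (β) with `|P₀|, |P₁| ≥ 2` — the open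
shape — through `tightening_split` and `diffsY_subset_diffsX_of_dichotomy` (p446425).
-/

namespace PercRepro.MSTight

open Finset
open scoped FinsetFamily

variable (α : Type*) [DecidableEq α] [Fintype α]

/-- **The local dichotomy (candidate Prop, never asserted).** For a tight twin-free family `P`
without `∅` and `univ`, an excess-one subfamily `K ⊆ P` and a partition `P ∖ K = P₀ ⊔ P₁` with
`|P₀|, |P₁| ≥ 2`, `P₁ \\ K ⊆ K \\ K` and `K \\ P₀ ⊆ K \\ K`: every member of `P₁` lies below a
member of `K`. -/
def LocalDichotomy : Prop :=
  ∀ (P K P₀ P₁ : Finset (Finset α)), Tight P → (∀ a b, Twin P a b → a = b) →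
    (∅ : Finset α) ∉ P → (univ : Finset α) ∉ P → K ⊆ P → P₀ ∪ P₁ = P \ K → Disjoint P₀ P₁ →
    (K \\ K).card = K.card + 1 → P₁ \\ K ⊆ K \\ K → K \\ P₀ ⊆ K \\ K →
    2 ≤ P₀.card → 2 ≤ P₁.card → ∀ t ∈ P₁, ∃ k ∈ K, t ⊆ k

variable {α} {r : α} {F : Finset (Finset α)}

omit [Fintype α] in
/-- The partnerless members partition the trace minus the partner family. -/
theorem partnerless_union_eq : (part0 r F \ partr r F) ∪ (partr r F \ part0 r F) =
    proj r F \ partner r F := by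
  rw [proj_eq_union, partner]
  ext E
  simp only [mem_union, mem_sdiff, mem_inter]
  tauto

omit [Fintype α] in
/-- The two partnerless families are disjoint. -/
theorem partnerless_disjoint : Disjoint (part0 r F \ partr r F) (partr r F \ part0 r F) := by
  rw [Finset.disjoint_left]
  intro E hE hE'
  exact (mem_sdiff.1 hE').2 (mem_sdiff.1 hE).1

omit [Fintype α] in
/-- `K ⊆ P`. -/
theorem partner_subset_proj' : partner r F ⊆ proj r F := by
  rw [proj_eq_union]
  exact inter_subset_left.trans subset_union_left

/-- **The bridge.** Under `LocalDichotomy α`, Conjecture (T) holds at every genuine twin-free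
tightening direction of an excess-one family in case (β) with at least two partnerless members on
each side (the open shape). -/
theorem diffsY_subset_diffsX_of_localDichotomy (hL : LocalDichotomy α)
    (hF : (F \\ F).card = F.card + 1) (hP : Tight (proj r F))
    (htf : ∀ a b, Twin (proj r F) a b → a = b)
    (hE : (∅ : Finset α) ∉ proj r F) (hU : (univ : Finset α) ∉ proj r F)
    (hβ : (partner r F \\ partner r F).card = (partner r F).card + 1)
    (h0 : 2 ≤ (part0 r F \ partr r F).card) (h1 : 2 ≤ (partr r F \ part0 r F).card) :
    diffsY r F ⊆ diffsX r F := by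
  -- case (β) of the tightening split: the two local inclusions
  have hsplit := tightening_split hF hP
  have hK1 : partr r F \\ partner r F = partner r F \\ partner r F := by
    rcases hsplit with ⟨hT, -⟩ | ⟨-, -, h, -⟩
    · exfalso
      unfold Tight at hT
      omega
    · exact h
  have hK0 : partner r F \\ part0 r F = partner r F \\ partner r F := by
    rcases hsplit with ⟨hT, -⟩ | ⟨-, -, -, h⟩
    · exfalso
      unfold Tight at hT
      omega
    · exact h
  have hP1 : (partr r F \ part0 r F) \\ partner r F ⊆ partner r F \\ partner r F := by
    rw [← hK1]
    exact diffs_subset sdiff_subset (subset_refl _)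
  have hP0 : partner r F \\ (part0 r F \ partr r F) ⊆ partner r F \\ partner r F := by
    rw [← hK0]
    exact diffs_subset (subset_refl _) sdiff_subset
  have hdich := hL (proj r F) (partner r F) (part0 r F \ partr r F) (partr r F \ part0 r F)
    hP htf hE hU partner_subset_proj' partnerless_union_eq partnerless_disjoint hβ hP1 hP0 h0 h1
  apply diffsY_subset_diffsX_of_dichotomy hP htf
  left
  intro t ht ht0
  exact hdich t (mem_sdiff.2 ⟨ht, ht0⟩)

end PercRepro.MSTight
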